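import Literature.Probability.RandomPlanarGeometry.ImaginaryGeometryHarmonic
import Literature.Probability.RandomPlanarGeometry.LoewnerCentredFlowIntegral
import HarnessLib

/-!
# The harmonic function `𝔥_t(z)` of Miller–Sheffield along the Loewner flow: slope form, `arg g_t'` as a time integral, approach times

Deterministic (one continuous driving function `W`, one point `z ∈ ℍ`) complements to
`ImaginaryGeometryHarmonic.lean` (J. Miller, S. Sheffield, *Imaginary geometry I*, PTRF 164
(2016), Thm. 1.1 / Fig. 1.10 and §2.3 Thm. 2.4), serving the proof of the forward direction of
Thm. 2.4 in its almost-sure form (`ImaginaryGeometryHarmonicProofs.lean`):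

* `arg_eq_pi_div_two_sub_arctan` — on the upper half-plane `arg Z = π/2 - arctan (re Z / im Z)`;
* `Loewner.im_neg_two_div_sq`, `Loewner.argDeriv_eq_integral` — the continuous argument of
  `g_t'(z)` (`Loewner.argDeriv`, `Im ∫₀ᵗ -2 ds/(g_s(z) - W_s)²`, Miller–Sheffield's
  `∂_t log f_t' = -2/f_t²`) is the time integral `∫₀ᵗ 4 x_s y_s/|z_s|⁴ ds` of a continuous real
  integrand before the swallowing time (`z_s = x_s + i y_s = g_s(z) - W_s`, `Loewner.centredMap`);
* `Loewner.imaginaryHarmonic_eq_arctan` — **the slope form of `𝔥_t(z)`**: for `t < T_z`,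
  `𝔥_t(z) = -λρ/2 + (2λ/π) arctan(x_t/y_t) + (λρ/π) arctan((x_t + W_t - V_t)/y_t) - χ arg g_t'(z)`,
  the form on which Itô's formula is run (one Itô process `x_t/y_t`, finite-variation factors);
* approach times (`Loewner.approachTime W z δ = inf{t : |g_t(z) - W_t| ≤ δ}`):
  `|z_t| > δ` strictly before it, `|z_t| ≥ δ` up to and including it, and — the point of the
  localisation — **`approachTime W z δ < T_z` whenever `T_z < ∞`** (a solution staying `δ`-away
  from the driving function is extendable, `IsSolution.coe_lt_swallowingTime_of_le_norm_sub`),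
  so that everything the theorem evaluates happens strictly before absorption;
* the elementary bound `|y/(x² + y²)| ≤ 1/|z|` controlling the diffusion coefficient of `𝔥`.

## References

* J. Miller, S. Sheffield, *Imaginary geometry I: interacting SLEs*, PTRF 164 (2016),
  arXiv:1201.1496: Thm. 1.1, Fig. 1.10, §2.3 Thm. 2.4 and its proof.
* G. F. Lawler, *Conformally Invariant Processes in the Plane* (2005), Ch. 4 §4.1 (the Loewner
  flow exists until `g_t(z) - W_t` hits `0`).
-/

noncomputable section

open Set Filter MeasureTheory Complex intervalIntegral
open _root_.Topology
open scoped NNReal Real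

namespace Literature.Probability.RandomPlanarGeometry

/-! ### `arg` through `arctan` on the upper half-plane -/

/-- On the open upper half-plane, `arg Z = π/2 - arctan (re Z / im Z)` (`arg Z = arccos(re Z/|Z|)`,
`arccos = π/2 - arcsin`, `arcsin (u/√(1+u²)) = arctan u` with `u = re Z/im Z`). [folklore] -/
theorem arg_eq_pi_div_two_sub_arctan {Z : ℂ} (hZ : 0 < Z.im) :
    arg Z = π / 2 - Real.arctan (Z.re / Z.im) := by
  rw [arg_of_im_pos hZ, Real.arccos_eq_pi_div_two_sub_arcsin, Real.arctan_eq_arcsin]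
  congr 2
  have hy : Z.im ≠ 0 := hZ.ne'
  have h1 : (1 : ℝ) + (Z.re / Z.im) ^ 2 = (Z.re ^ 2 + Z.im ^ 2) / Z.im ^ 2 := by
    field_simp
    ring
  have h2 : Real.sqrt (1 + (Z.re / Z.im) ^ 2) = ‖Z‖ / Z.im := by
    rw [h1, Real.sqrt_div' _ (sq_nonneg _), Real.sqrt_sq hZ.le, norm_eq_sqrt_sq_add_sq]
  rw [h2]
  have hn : ‖Z‖ ≠ 0 := by
    intro h
    rw [norm_eq_zero] at h
    rw [h, zero_im] at hZ
    exact lt_irrefl _ hZ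
  field_simp

/-- `|im Z / (re Z² + im Z²)| ≤ 1/|Z|` (`re² + im² = |Z|²`, `|im Z| ≤ |Z|`). [folklore] -/
theorem abs_im_div_sq_add_sq_le (Z : ℂ) : |Z.im / (Z.re ^ 2 + Z.im ^ 2)| ≤ ‖Z‖⁻¹ := by
  have hsq : Z.re ^ 2 + Z.im ^ 2 = ‖Z‖ ^ 2 := by
    rw [Complex.sq_norm, normSq_apply]; ring
  rw [hsq]
  by_cases h0 : ‖Z‖ = 0
  · rw [h0]; simp
  have hpos : 0 < ‖Z‖ := lt_of_le_of_ne (norm_nonneg _) (Ne.symm h0)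
  rw [abs_div, abs_of_pos (pow_pos hpos 2), div_le_iff₀ (pow_pos hpos 2)]
  calc |Z.im| ≤ ‖Z‖ := abs_im_le_norm Z
    _ = ‖Z‖⁻¹ * ‖Z‖ ^ 2 := by field_simp

namespace Loewner

variable {W : ℝ≥0 → ℝ} {z : ℂ}

/-! ### `arg g_t'(z)` as a time integral -/

/-- `Im (-2/Z²) = 4 re Z im Z / |Z|⁴`. [folklore] -/
theorem im_neg_two_div_sq (Z : ℂ) : (-2 / Z ^ 2).im = 4 * Z.re * Z.im / ‖Z‖ ^ 4 := by
  have h4 : ‖Z‖ ^ 4 = normSq (Z ^ 2) := by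
    rw [map_pow, normSq_eq_norm_sq]; ring
  rw [h4, div_im]
  simp only [neg_im, neg_re, re_ofNat, im_ofNat, neg_zero, zero_mul, zero_div, zero_sub]
  have him : (Z ^ 2).im = 2 * Z.re * Z.im := by rw [sq, mul_im]; ring
  rw [him]
  ring

/-- Real times in `[0, t]`, `t < T_z`, are before the swallowing time. [folklore] -/
theorem toNNReal_lt_swallowingTime_of_mem {t : ℝ≥0} (ht : (t : WithTop ℝ≥0) < swallowingTime W z)
    {s : ℝ} (hs : s ∈ Icc (0 : ℝ) t) : (s.toNNReal : WithTop ℝ≥0) < swallowingTime W z :=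
  lt_of_le_of_lt (WithTop.coe_le_coe.2 (Real.toNNReal_le_iff_le_coe.2 hs.2)) ht

/-- Strictly before the approach time the flow is more than `δ` away from the driving
function: `↑t < approachTime W z δ → δ < |z_t|` (definition of the infimum; no continuity
needed). [folklore] -/
theorem lt_norm_centredMap_of_coe_lt_approachTime {δ : ℝ} {t : ℝ≥0}
    (ht : (t : WithTop ℝ≥0) < approachTime W z δ) : δ < ‖centredMap W t z‖ := by
  by_contra h
  rw [not_lt] at h
  have h' : ‖map W t z - (W t : ℂ)‖ ≤ δ := by rwa [← centredMap_apply]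
  exact (not_le.2 ht) (approachTime_le h')

section Flow

variable (hW : Continuous W) (hz : 0 < z.im)
include hW hz

/-- `s ↦ z_{s⁺}` is continuous on `[0, t]` for `t < T_z` (real time read through `Real.toNNReal`).
[folklore] -/
theorem continuousOn_centredMap_toNNReal {t : ℝ≥0} (ht : (t : WithTop ℝ≥0) < swallowingTime W z) :
    ContinuousOn (fun s : ℝ ↦ centredMap W s.toNNReal z) (Icc 0 t) := by
  have hzW : z ≠ W 0 := ne_driving_of_im_pos hz 0
  refine (continuousOn_centredMap hW hzW).comp continuous_real_toNNReal.continuousOn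
    fun s hs ↦ ?_
  exact lt_of_le_of_lt (WithTop.coe_le_coe.2 (Real.toNNReal_le_iff_le_coe.2 hs.2)) ht

/-- **`arg g_t'(z) = ∫₀ᵗ 4 x_s y_s / |z_s|⁴ ds`** for `t < T_z`: the continuous argument of
`g_t'(z)` (`Loewner.argDeriv`, the imaginary part of `∫₀ᵗ -2 ds/z_s²`, from Miller–Sheffield's
`∂_t log f_t'(z) = -2/f_t²(z)`) is the time integral of the continuous real integrand
`Im(-2/z_s²) = 4 x_s y_s/|z_s|⁴`. [cite: MillerSheffield2016, proof of Thm. 2.4 (d/dt log f_t')] -/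
theorem argDeriv_eq_integral {t : ℝ≥0} (ht : (t : WithTop ℝ≥0) < swallowingTime W z) :
    argDeriv W t z = ∫ s in (0 : ℝ)..t, 4 * (centredMap W s.toNNReal z).re *
      (centredMap W s.toNNReal z).im / ‖centredMap W s.toNNReal z‖ ^ 4 := by
  have hcont := continuousOn_centredMap_toNNReal hW hz ht
  have hne : ∀ s ∈ Icc (0 : ℝ) t, centredMap W s.toNNReal z ≠ 0 := fun s hs ↦
    centredMap_ne_zero hW hz (toNNReal_lt_swallowingTime_of_mem ht hs)
  have hcontF : ContinuousOn (fun s : ℝ ↦ (-2 : ℂ) / (centredMap W s.toNNReal z) ^ 2) (Icc 0 t) :=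
    continuousOn_const.div (hcont.pow 2) fun s hs ↦ pow_ne_zero 2 (hne s hs)
  have hint : IntervalIntegrable (fun s : ℝ ↦ (-2 : ℂ) / (centredMap W s.toNNReal z) ^ 2) volume 0 t :=
    hcontF.intervalIntegrable_of_Icc t.coe_nonneg
  have h1 : argDeriv W t z = (∫ s in (0 : ℝ)..t, (-2 : ℂ) / (centredMap W s.toNNReal z) ^ 2).im := rfl
  have h2 := Complex.imCLM.intervalIntegral_comp_comm hint
  simp only [imCLM_apply] at h2
  rw [h1, ← h2]
  refine integral_congr fun s _ ↦ ?_
  simp only [im_neg_two_div_sq]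

/-- The integrand of `argDeriv_eq_integral` is continuous on `[0, t]`, `t < T_z`. [folklore] -/
theorem continuousOn_argDerivRate {t : ℝ≥0} (ht : (t : WithTop ℝ≥0) < swallowingTime W z) :
    ContinuousOn (fun s : ℝ ↦ 4 * (centredMap W s.toNNReal z).re *
      (centredMap W s.toNNReal z).im / ‖centredMap W s.toNNReal z‖ ^ 4) (Icc 0 t) := by
  have hcont := continuousOn_centredMap_toNNReal hW hz ht
  have hne : ∀ s ∈ Icc (0 : ℝ) t, centredMap W s.toNNReal z ≠ 0 := fun s hs ↦
    centredMap_ne_zero hW hz (toNNReal_lt_swallowingTime_of_mem ht hs)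
  refine ((continuousOn_const.mul (continuous_re.comp_continuousOn hcont)).mul
    (continuous_im.comp_continuousOn hcont)).div (hcont.norm.pow 4) fun s hs ↦ ?_
  exact pow_ne_zero 4 (norm_ne_zero_iff.2 (hne s hs))

/-! ### The slope form of `𝔥_t(z)` -/

/-- **Slope form of `𝔥_t(z)`** (Miller–Sheffield 2016, Thm. 1.1 / Fig. 1.10, one left force
point): for `t < T_z` and any force-point function `V`,
`𝔥_t(z) = -λρ/2 + (2λ/π) arctan(x_t/y_t) + (λρ/π) arctan((x_t + W_t - V_t)/y_t) - χ arg g_t'(z)`,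
where `z_t = x_t + i y_t = g_t(z) - W_t` (so that `g_t(z) - V_t = z_t + (W_t - V_t)` has the same
imaginary part `y_t > 0`), by `arg Z = π/2 - arctan(re Z/im Z)` on `ℍ`.
[cite: MillerSheffield2016, Thm. 1.1 and Fig. 1.10] -/
theorem imaginaryHarmonic_eq_arctan (κ : ℝ≥0) (ρ : ℝ) (V : ℝ≥0 → ℝ) {t : ℝ≥0}
    (ht : (t : WithTop ℝ≥0) < swallowingTime W z) :
    imaginaryHarmonic κ ρ W V z t = -(igLambda κ * ρ / 2) +
      2 * igLambda κ / π * Real.arctan ((centredMap W t z).re / (centredMap W t z).im) +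
      igLambda κ * ρ / π *
        Real.arctan (((centredMap W t z).re + (W t - V t)) / (centredMap W t z).im) -
      igChi κ * argDeriv W t z := by
  have hy := im_centredMap_pos hW hz ht
  have h1 : arg (map W t z - (W t : ℂ)) =
      π / 2 - Real.arctan ((centredMap W t z).re / (centredMap W t z).im) := by
    rw [← centredMap_apply]
    exact arg_eq_pi_div_two_sub_arctan hy
  have hsum : map W t z - (V t : ℂ) = centredMap W t z + ((W t - V t : ℝ) : ℂ) := by
    rw [centredMap_apply]
    push_cast
    ring
  have hy' : 0 < (centredMap W t z + ((W t - V t : ℝ) : ℂ)).im := by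
    simpa using hy
  have h2 : arg (map W t z - (V t : ℂ)) =
      π / 2 - Real.arctan (((centredMap W t z).re + (W t - V t)) / (centredMap W t z).im) := by
    rw [hsum, arg_eq_pi_div_two_sub_arctan hy']
    simp
  unfold imaginaryHarmonic
  rw [h1, h2]
  have hπ : (π : ℝ) ≠ 0 := Real.pi_ne_zero
  field_simp
  ring

/-! ### Approach times -/

/-- **Approach happens strictly before absorption**: if `T_z < ∞` then
`approachTime W z δ < T_z` for every `δ > 0`. Otherwise the maximal solution would stay `δ`-away
from the driving function on `[0, T_z)` and could be continued past `T_z`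
(`IsSolution.coe_lt_swallowingTime_of_le_norm_sub`), contradicting maximality. This is why
"until the time `z` is absorbed by `K_t`" (Miller–Sheffield 2016, Thm. 2.4) is exhausted by the
approach times as `δ ↓ 0`. [cite: Lawler2005, Ch. 4 §4.1] -/
theorem approachTime_lt_swallowingTime {δ : ℝ} (hδ : 0 < δ) (hT : swallowingTime W z ≠ ⊤) :
    approachTime W z δ < swallowingTime W z := by
  have hzW : z ≠ W 0 := ne_driving_of_im_pos hz 0
  obtain ⟨b, hb⟩ := WithTop.ne_top_iff_exists.1 hT
  rw [← hb]
  by_contra hle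
  rw [not_lt] at hle
  have hb0 : (0 : WithTop ℝ≥0) < b := by rw [hb]; exact swallowingTime_pos_holds hW hzW
  have hb0' : 0 < b := by exact_mod_cast hb0
  obtain ⟨g, hg⟩ := exists_isSolution_swallowingTime_holds hW hzW
  rw [← hb] at hg
  have hδ' : 0 < δ.toNNReal := Real.toNNReal_pos.2 hδ
  have hfar : ∀ t : ℝ, 0 ≤ t → t < b → (δ.toNNReal : ℝ) ≤ ‖g t - W t.toNNReal‖ := by
    intro t ht0 htb
    have htb' : (t.toNNReal : WithTop ℝ≥0) < (b : WithTop ℝ≥0) :=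
      WithTop.coe_lt_coe.2 ((Real.toNNReal_lt_iff_lt_coe ht0).2 htb)
    have heq : (g t : ℂ) - W t.toNNReal = centredMap W t.toNNReal z := by
      rw [centredMap_eq_of_isSolution hW hg htb', Real.coe_toNNReal _ ht0]
    rw [heq, Real.coe_toNNReal _ hδ.le]
    exact (lt_norm_centredMap_of_coe_lt_approachTime (lt_of_lt_of_le htb' hle)).le
  have hlt := hg.coe_lt_swallowingTime_of_le_norm_sub hW hb0' hδ' hfar
  rw [← hb] at hlt
  exact lt_irrefl _ hlt

/-- If the point is never absorbed or approached: `approachTime = ⊤` forces `T_z = ⊤`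
(contrapositive of `approachTime_lt_swallowingTime`). [folklore] -/
theorem swallowingTime_eq_top_of_approachTime_eq_top {δ : ℝ} (hδ : 0 < δ)
    (h : approachTime W z δ = ⊤) : swallowingTime W z = ⊤ := by
  by_contra hT
  have := approachTime_lt_swallowingTime hW hz hδ hT
  rw [h] at this
  exact not_top_lt this

/-- **Up to and including a positive approach time the flow is at least `δ` away** from the
driving function (`δ ≤ |z_s|` for `0 < s ≤ approachTime W z δ`, `s < T_z`): strictly before, the
strict inequality holds by definition, and at the approach time itself by continuity of
`s ↦ |z_s|` from the left. [folklore] -/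
theorem le_norm_centredMap_of_coe_le_approachTime {δ : ℝ} {s : ℝ≥0} (h0 : 0 < s)
    (hs : (s : WithTop ℝ≥0) ≤ approachTime W z δ) (hsT : (s : WithTop ℝ≥0) < swallowingTime W z) :
    δ ≤ ‖centredMap W s z‖ := by
  rcases hs.lt_or_eq with hlt | heq
  · exact (lt_norm_centredMap_of_coe_lt_approachTime hlt).le
  -- continuity from the left along real times
  have hzW : z ≠ W 0 := ne_driving_of_im_pos hz 0
  set G : ℝ → ℝ := fun r ↦ ‖centredMap W r.toNNReal z‖ with hG
  have hcontAt : ContinuousAt G s := by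
    have hopen : IsOpen {r : ℝ≥0 | (r : WithTop ℝ≥0) < swallowingTime W z} := by
      have : {r : ℝ≥0 | (r : WithTop ℝ≥0) < swallowingTime W z} =
          (fun r : ℝ≥0 ↦ (r : WithTop ℝ≥0)) ⁻¹' Iio (swallowingTime W z) := rfl
      rw [this]
      exact isOpen_Iio.preimage WithTop.continuous_coe
    have h1 : ContinuousAt (fun r : ℝ≥0 ↦ centredMap W r z) s :=
      (continuousOn_centredMap hW hzW).continuousAt (hopen.mem_nhds hsT)
    have h2 : ContinuousAt (fun r : ℝ ↦ centredMap W r.toNNReal z) (s : ℝ) := by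
      have h1' : ContinuousAt (fun r : ℝ≥0 ↦ centredMap W r z) ((s : ℝ).toNNReal) := by
        rwa [Real.toNNReal_coe]
      exact ContinuousAt.comp h1' continuous_real_toNNReal.continuousAt
    exact h2.norm
  have htend : Tendsto G (𝓝[<] (s : ℝ)) (𝓝 (G s)) := hcontAt.tendsto.mono_left nhdsWithin_le_nhds
  have hs0 : (0 : ℝ) < s := by exact_mod_cast h0
  have hev : ∀ᶠ r in 𝓝[<] (s : ℝ), δ < G r := by
    filter_upwards [Ioo_mem_nhdsLT hs0] with r hr
    have hr' : ((r.toNNReal : ℝ≥0) : WithTop ℝ≥0) < approachTime W z δ := by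
      rw [← heq, WithTop.coe_lt_coe, ← NNReal.coe_lt_coe, Real.coe_toNNReal _ hr.1.le]
      exact hr.2
    exact lt_norm_centredMap_of_coe_lt_approachTime hr'
  have hGs : G s = ‖centredMap W s z‖ := by simp [hG]
  rw [← hGs]
  exact ge_of_tendsto htend (hev.mono fun r hr ↦ hr.le)

/-- Variant of `le_norm_centredMap_of_coe_le_approachTime` without the positivity side
condition, when the starting point is far: if `δ < |z - W 0|` then `δ ≤ |z_s|` for all
`s ≤ approachTime W z δ` with `s < T_z`. [folklore] -/
theorem le_norm_centredMap_of_coe_le_approachTime' {δ : ℝ} (hδz : δ < ‖z - (W 0 : ℂ)‖) {s : ℝ≥0}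
    (hs : (s : WithTop ℝ≥0) ≤ approachTime W z δ) (hsT : (s : WithTop ℝ≥0) < swallowingTime W z) :
    δ ≤ ‖centredMap W s z‖ := by
  rcases (show (0 : ℝ≥0) ≤ s from bot_le).eq_or_lt with h0 | h0
  · rw [← h0, centredMap_zero hW (ne_driving_of_im_pos hz 0)]
    exact hδz.le
  · exact le_norm_centredMap_of_coe_le_approachTime hW hz h0 hs hsT

/-- **The diffusion-coefficient bound**: up to a positive approach time (and before `T_z`),
`|y_s / (x_s² + y_s²)| ≤ 1/δ`. [folklore] -/
theorem abs_im_div_normSq_le_of_coe_le_approachTime {δ : ℝ} (hδ : 0 < δ) {s : ℝ≥0} (h0 : 0 < s)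
    (hs : (s : WithTop ℝ≥0) ≤ approachTime W z δ) (hsT : (s : WithTop ℝ≥0) < swallowingTime W z) :
    |(centredMap W s z).im / ((centredMap W s z).re ^ 2 + (centredMap W s z).im ^ 2)| ≤ δ⁻¹ := by
  have h1 := abs_im_div_sq_add_sq_le (centredMap W s z)
  have h2 := le_norm_centredMap_of_coe_le_approachTime hW hz h0 hs hsT
  exact h1.trans (inv_anti₀ hδ h2)

end Flow

end Loewner

end Literature.Probability.RandomPlanarGeometry
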